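import Summits.AtomisticToContinuum.Crystallization.Theorems.PhononSlackCertificatesPeriodicGivenLayeredLayerCake1
import Summits.AtomisticToContinuum.Crystallization.Theorems.PhononSlackCertificatesPeriodicGivenLayeredLayerCake2
import Literature.MathematicalPhysics.StatisticalMechanics.LennardJonesClusters

/-!
# `PeriodicGivenLayered` (stmt-AtomisticToContinuum-11779), line `Sketch`, helper for stub `stub_layerCake`:
# decay and summability of the Lennard-Jones layer sums; the site energy layer by layer

Support file for the crux `PhononSlackCertificates.PeriodicGivenLayered` (= `HullMinimality.PeriodicGivenLayered`).
With the inverse-cube layer sum bound of part 2 (`cake_sum_layer_inv_cube_le`) and `|V_LJ(r)| ≤ r⁻⁶` for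
`r ≥ 7/10` (`cake_abs_lennardJones_le`):

* `cake_summable_abs_layer`, `cake_abs_layerInteraction_le` — for `a ∈ [47/50, 1]`, `|H| ≥ 7/10` and any offset
  `δ`, the family `V_LJ ‖layerVec a H δ 1 p q‖` is absolutely summable over `ℤ²` with
  `∑ |V_LJ| ≤ 192 / H⁴`, hence `|layerInteraction lennardJones a H δ 1| ≤ 192 / H⁴` (deliverable (a) of the stub);
* `cake_summable_abs_inLayer` — the in-layer family `V_LJ ‖p u + q v‖` is absolutely summable;
* `cake_summable_of_layer_bound`, `cake_summable_layers` — sums over the layers `m' ≠ m` of quantities bounded by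
  `192 / (z m' - z m)⁴` converge for heights with increments `≥ 39a/50` (deliverable (c) of the stub);
* `cake_siteEnergy` — deliverable (d): for the layered set `S = S(A, s, z)` and its point
  `p₀ = A (i u + j v + L(m) w + z(m) e₃)`,
  `∑'_{q ∈ S, q ≠ p₀} V_LJ (dist p₀ q) = Φ₀(a) + ∑'_{m' ≠ m} layerInteraction V_LJ a (z m' − z m) (L m' − L m) 1`.
  This is the regrouping by layers of the absolutely convergent sum over the point set that
  `BarlowStackingEnergy.lean` left undone (there the layer-by-layer organisation is the DEFINITION of
  `barlowSiteEnergy`), here for free heights: `S` is parametrised injectively by `ℤ × ℤ × ℤ`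
  (`cake_param_injective`), the family is absolutely summable, `Summable.tsum_prod` regroups it, the slice
  `m' = m` is the punctured in-layer sum `Φ₀ = inLayerInteraction` (the puncture is free since `V_LJ 0 = 0`) and
  the slices `m' ≠ m` are `layerInteraction`s after an in-layer translation.
-/

namespace Summit.AtomisticToContinuum.Crystallization.Theorems.LayeredHull

open Literature.MathematicalPhysics.StatisticalMechanics

/-! ## The Lennard-Jones potential beyond `7/10` -/

/-- `|V_LJ(r)| ≤ (r²)⁻³` as soon as `r² ≥ 49/100` (then `r⁻⁶ ≤ (100/49)³ < 9`, and
`|u²/12 - u/6| ≤ u` for `0 ≤ u = r⁻⁶ ≤ 9`). [folklore] -/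
theorem cake_abs_lennardJones_le {r : ℝ} (h : 49 / 100 ≤ r ^ 2) :
    |lennardJones r| ≤ ((r ^ 2)⁻¹) ^ 3 := by
  set u : ℝ := ((r ^ 2)⁻¹) ^ 3 with hu
  have hr2 : 0 < r ^ 2 := by linarith
  have hu0 : 0 ≤ u := by positivity
  have hinv : (r ^ 2)⁻¹ ≤ 100 / 49 := by
    rw [inv_eq_one_div, div_le_div_iff₀ hr2 (by norm_num)]; linarith
  have hu1 : u ≤ (100 / 49) ^ 3 := by
    rw [hu]; exact pow_le_pow_left₀ (by positivity) hinv 3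
  have hLJ : lennardJones r = u ^ 2 / 12 - u / 6 := by
    unfold lennardJones; rw [hu]; ring
  rw [hLJ, abs_le]
  constructor <;> nlinarith [hu0, hu1, mul_nonneg hu0 hu0]

/-- Pointwise bound of the layer terms: `|V_LJ ‖layerVec a H δ 1 p q‖| ≤ (‖layerVec a H δ 1 p q‖²)⁻³` for
`|H| ≥ 7/10`. [folklore] -/
theorem cake_abs_lennardJones_layerVec_le (a H : ℝ) (hH : 7 / 10 ≤ |H|) (δ p q : ℤ) :
    |lennardJones ‖layerVec a H δ 1 p q‖| ≤ ((‖layerVec a H δ 1 p q‖ ^ 2)⁻¹) ^ 3 := by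
  apply cake_abs_lennardJones_le
  have h1 := cake_abs_height_le_norm a H δ p q
  have h2 : (7 / 10 : ℝ) ^ 2 ≤ ‖layerVec a H δ 1 p q‖ ^ 2 := pow_le_pow_left₀ (by norm_num) (hH.trans h1) 2
  nlinarith

/-! ## Decay of the layer sums -/

/-- **Absolute summability and decay of a layer sum.** For `a ∈ [47/50, 1]`, `|H| ≥ 7/10`, any offset `δ`:
`∑_{(p,q) ∈ ℤ²} |V_LJ ‖layerVec a H δ 1 p q‖| ≤ 192 / H⁴` (and the family is summable). [folklore] -/
theorem cake_summable_abs_layer (a H : ℝ) (ha : 47 / 50 ≤ a) (ha1 : a ≤ 1) (hH : 7 / 10 ≤ |H|) (δ : ℤ) :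
    Summable (fun pq : ℤ × ℤ => |lennardJones ‖layerVec a H δ 1 pq.1 pq.2‖|) ∧
      ∑' pq : ℤ × ℤ, |lennardJones ‖layerVec a H δ 1 pq.1 pq.2‖| ≤ 192 / H ^ 4 := by
  have hle : ∀ u : Finset (ℤ × ℤ),
      ∑ pq ∈ u, |lennardJones ‖layerVec a H δ 1 pq.1 pq.2‖| ≤ 192 / H ^ 4 := fun u =>
    (Finset.sum_le_sum fun pq _ => cake_abs_lennardJones_layerVec_le a H hH δ pq.1 pq.2).trans
      (cake_sum_layer_inv_cube_le a H ha ha1 hH δ u)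
  exact ⟨summable_of_sum_le (fun _ => abs_nonneg _) hle, Real.tsum_le_of_sum_le (fun _ => abs_nonneg _) hle⟩

/-- **Deliverable (a): decay of the layer interaction.** `|layerInteraction lennardJones a H δ 1| ≤ 192 / H⁴` for
`a ∈ [47/50, 1]`, `|H| ≥ 7/10`, any offset `δ`. [folklore] -/
theorem cake_abs_layerInteraction_le (a H : ℝ) (ha : 47 / 50 ≤ a) (ha1 : a ≤ 1) (hH : 7 / 10 ≤ |H|) (δ : ℤ) :
    |layerInteraction lennardJones a H δ 1| ≤ 192 / H ^ 4 := by
  obtain ⟨hs, ht⟩ := cake_summable_abs_layer a H ha ha1 hH δ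
  unfold layerInteraction
  have h1 : ‖∑' pq : ℤ × ℤ, lennardJones ‖layerVec a H δ 1 pq.1 pq.2‖‖ ≤
      ∑' pq : ℤ × ℤ, ‖lennardJones ‖layerVec a H δ 1 pq.1 pq.2‖‖ :=
    norm_tsum_le_tsum_norm (by simpa only [Real.norm_eq_abs] using hs)
  simp only [Real.norm_eq_abs] at h1
  exact h1.trans ht

/-- The layer family itself is summable (`|H| ≥ 7/10`). [folklore] -/
theorem cake_summable_layer (a H : ℝ) (ha : 47 / 50 ≤ a) (ha1 : a ≤ 1) (hH : 7 / 10 ≤ |H|) (δ : ℤ) :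
    Summable (fun pq : ℤ × ℤ => lennardJones ‖layerVec a H δ 1 pq.1 pq.2‖) :=
  (cake_summable_abs_layer a H ha ha1 hH δ).1.of_abs

/-! ## The in-layer family -/

/-- **Absolute summability of the in-layer family** `V_LJ ‖layerVec a 0 0 1 p q‖ = V_LJ ‖p u + q v‖` (the origin
contributes `V_LJ 0 = 0`; off the origin `‖p u + q v‖² = a² (p² + pq + q²) ≥ a²`, and the term is dominated by
`8` times the layer term at the fictitious height `H = a`). [folklore] -/
theorem cake_summable_abs_inLayer (a : ℝ) (ha : 47 / 50 ≤ a) (ha1 : a ≤ 1) :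
    Summable (fun pq : ℤ × ℤ => |lennardJones ‖layerVec a 0 0 1 pq.1 pq.2‖|) := by
  have ha0 : 0 < a := by linarith
  have haH : 7 / 10 ≤ |a| := by rw [abs_of_pos ha0]; linarith
  have hT : Summable (fun pq : ℤ × ℤ => 8 * ((‖layerVec a a 0 1 pq.1 pq.2‖ ^ 2)⁻¹) ^ 3) :=
    (summable_of_sum_le (fun _ => by positivity) (cake_sum_layer_inv_cube_le a a ha ha1 haH 0)).mul_left 8
  refine Summable.of_nonneg_of_le (fun _ => abs_nonneg _) (fun pq => ?_) hT
  rcases eq_or_ne (pq.1, pq.2) 0 with h0 | h0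
  · have h1 : pq.1 = 0 ∧ pq.2 = 0 := by simpa [Prod.ext_iff] using h0
    have hn : ‖layerVec a 0 0 1 pq.1 pq.2‖ = 0 := by
      have := cake_norm_layerVec_inLayer_sq a pq.1 pq.2
      rw [h1.1, h1.2] at this ⊢
      simpa using this
    rw [hn, lennardJones_zero, abs_zero]
    positivity
  · have hQ : (1 : ℝ) ≤ ((pq.1 ^ 2 + pq.1 * pq.2 + pq.2 ^ 2 : ℤ) : ℝ) := by
      exact_mod_cast one_le_sq_add_mul_add_sq h0
    push_cast at hQ
    set S := ‖layerVec a 0 0 1 pq.1 pq.2‖ ^ 2 with hS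
    have hS' : S = a ^ 2 * ((pq.1 : ℝ) ^ 2 + pq.1 * pq.2 + pq.2 ^ 2) :=
      cake_norm_layerVec_inLayer_sq a pq.1 pq.2
    have hSa : a ^ 2 ≤ S := by rw [hS']; nlinarith [sq_nonneg a]
    have ha2 : 22 / 25 ≤ a ^ 2 := by nlinarith
    have hS49 : 49 / 100 ≤ S := by linarith
    have hsum : ‖layerVec a a 0 1 pq.1 pq.2‖ ^ 2 = S + a ^ 2 := by
      rw [cake_norm_layerVec_sq, hS']; push_cast; ring
    have hSpos : 0 < S := by linarith
    have hinv : S⁻¹ ≤ ((S + a ^ 2) / 2)⁻¹ := inv_anti₀ (by positivity) (by linarith)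
    calc |lennardJones ‖layerVec a 0 0 1 pq.1 pq.2‖| ≤ (S⁻¹) ^ 3 := cake_abs_lennardJones_le hS49
      _ ≤ (((S + a ^ 2) / 2)⁻¹) ^ 3 := pow_le_pow_left₀ (by positivity) hinv 3
      _ = 8 * ((‖layerVec a a 0 1 pq.1 pq.2‖ ^ 2)⁻¹) ^ 3 := by
          rw [hsum, inv_div, div_pow, inv_pow]
          ring

/-! ## Sums over the layers -/

/-- **Summation over the layers.** If `|f m'| ≤ 192 / (z m' - z m)⁴` for `m' ≠ m` and the heights have increments
`≥ 39a/50` (`a ≥ 47/50`), then `f` is summable over `ℤ` (comparison with `C / (m' - m)⁴`). [folklore] -/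
theorem cake_summable_of_layer_bound (a : ℝ) (ha : 47 / 50 ≤ a) (z : ℤ → ℝ)
    (hz : ∀ m : ℤ, 39 / 50 * a ≤ z (m + 1) - z m) (m : ℤ) (f : ℤ → ℝ)
    (hf : ∀ m', m' ≠ m → |f m'| ≤ 192 / (z m' - z m) ^ 4) : Summable f := by
  set c : ℝ := 39 / 50 * a with hc
  have hcpos : 0 < c := by rw [hc]; linarith
  have h4 : Summable fun n : ℤ => 1 / (n : ℝ) ^ 4 := Real.summable_one_div_int_pow.2 (by norm_num)
  have h5 : Summable fun m' : ℤ => 1 / (((m' - m : ℤ) : ℝ)) ^ 4 := by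
    have h5' := h4.comp_injective (sub_left_injective (b := m))
    refine h5'.congr fun m' => ?_
    simp only [Function.comp_apply]
  have h6 : Summable fun m' : ℤ => if m' = m then |f m| else (0 : ℝ) :=
    summable_of_ne_finset_zero (s := {m}) fun m' hm' => by
      rw [Finset.mem_singleton] at hm'
      rw [if_neg hm']
  have hg : Summable fun m' : ℤ =>
      192 / c ^ 4 * (1 / (((m' - m : ℤ) : ℝ)) ^ 4) + (if m' = m then |f m| else 0) :=
    (h5.mul_left _).add h6
  refine Summable.of_norm_bounded hg fun m' => ?_
  rw [Real.norm_eq_abs]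
  by_cases hm : m' = m
  · rw [if_pos hm, hm]
    have : (0 : ℝ) ≤ 192 / c ^ 4 * (1 / (((m - m : ℤ) : ℝ)) ^ 4) := by positivity
    linarith
  · rw [if_neg hm, add_zero]
    refine (hf m' hm).trans ?_
    have h2 := cake_abs_height_diff_ge a (by linarith) z hz m m'
    have hne : (0 : ℝ) < |((m' : ℝ) - m)| := abs_pos.2 (sub_ne_zero.2 (by exact_mod_cast hm))
    have h3 : (c * |((m' : ℝ) - m)|) ^ 4 ≤ (z m' - z m) ^ 4 := by
      rw [← abs_of_nonneg (by positivity : (0 : ℝ) ≤ (z m' - z m) ^ 4), ← pow_abs]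
      exact pow_le_pow_left₀ (by positivity) h2 4
    calc 192 / (z m' - z m) ^ 4 ≤ 192 / (c * |((m' : ℝ) - m)|) ^ 4 :=
          div_le_div_of_nonneg_left (by norm_num) (pow_pos (mul_pos hcpos hne) 4) h3
      _ = 192 / c ^ 4 * (1 / (((m' - m : ℤ) : ℝ)) ^ 4) := by
          push_cast
          rw [mul_pow, pow_abs, abs_of_nonneg (by positivity : (0 : ℝ) ≤ ((m' : ℝ) - m) ^ 4)]
          field_simp

/-- **Deliverable (c): summability over the layers of the layer interactions** seen from layer `m`, for
`a ∈ [47/50, 1]` and heights in the box. [folklore] -/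
theorem cake_summable_layers (a : ℝ) (ha : 47 / 50 ≤ a) (ha1 : a ≤ 1) (s : ℤ → ℤ) (z : ℤ → ℝ)
    (hz : ∀ m : ℤ, 39 / 50 * a ≤ z (m + 1) - z m) (m : ℤ) :
    Summable fun m' : ℤ => if m' = m then (0 : ℝ) else
      layerInteraction lennardJones a (z m' - z m) (haggLabel s m' - haggLabel s m) 1 := by
  refine cake_summable_of_layer_bound a ha z hz m _ fun m' hm => ?_
  rw [if_neg hm]
  exact cake_abs_layerInteraction_le a _ ha ha1 (cake_height_sep a ha z hz hm) _

/-! ## The in-layer slice -/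

/-- `layerNormal 0 = 0`. [folklore] -/
theorem cake_layerNormal_zero : layerNormal 0 = (0 : (EuclideanSpace ℝ (Fin 3))) := by
  ext i
  fin_cases i <;> simp [layerNormal]

/-- At height `0` and offset `0`, `layerVec a 0 0 1 p q = p u + q v`. [folklore] -/
theorem cake_layerVec_height_zero (a : ℝ) (p q : ℤ) :
    layerVec a 0 0 1 p q = (p : ℝ) • triangularVec₁ a + (q : ℝ) • triangularVec₂ a := by
  simp [layerVec, cake_layerNormal_zero]

/-- The layer interaction of a layer with itself (height `0`, offset `0`) is the punctured in-layer sum `Φ₀`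
(the origin contributes `V_LJ 0 = 0`). [folklore] -/
theorem cake_layerInteraction_self (a : ℝ) :
    layerInteraction lennardJones a 0 0 1 = inLayerInteraction lennardJones a := by
  unfold layerInteraction inLayerInteraction
  refine tsum_congr fun ij => ?_
  split_ifs with h
  · rw [h, cake_layerVec_height_zero]
    simp [lennardJones_zero]
  · rw [cake_layerVec_height_zero]

/-! ## Pointwise `tsum` bookkeeping -/

/-- Removing a point where the summand vanishes does not change a sum over a set. [folklore] -/
theorem cake_tsum_subtype_ne_eq (f : (EuclideanSpace ℝ (Fin 3)) → ℝ) (S : Set (EuclideanSpace ℝ (Fin 3))) (p₀ :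
    (EuclideanSpace ℝ (Fin 3))) (h0 : f p₀ = 0) :
    ∑' q : {q : (EuclideanSpace ℝ (Fin 3)) // q ∈ S ∧ q ≠ p₀}, f q = ∑' q : S, f q := by
  rw [tsum_eq_tsum_sdiff_singleton S h0]
  rfl

/-- A sum over `ℤ` whose value at `m` is `c`: `∑' m', g m' = c + ∑' m', (if m' = m then 0 else g m')` when the
punctured family is summable. [folklore] -/
theorem cake_tsum_eq_add_tsum_ite (g : ℤ → ℝ) (m : ℤ) (c : ℝ) (hc : g m = c)
    (hg : Summable fun m' : ℤ => if m' = m then (0 : ℝ) else g m') :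
    ∑' m', g m' = c + ∑' m', (if m' = m then (0 : ℝ) else g m') := by
  have hsplit : g = fun m' => (if m' = m then c else 0) + (if m' = m then (0 : ℝ) else g m') := by
    ext m'
    by_cases h : m' = m
    · subst h; simp [hc]
    · simp [h]
  have h1 : Summable fun m' : ℤ => if m' = m then c else (0 : ℝ) :=
    summable_of_ne_finset_zero (s := {m}) fun m' hm' => by
      rw [Finset.mem_singleton] at hm'; rw [if_neg hm']
  conv_lhs => rw [hsplit]
  rw [h1.tsum_add hg, tsum_eq_single m (fun m' hm' => if_neg hm'), if_pos rfl]

/-! ## The site energy -/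

/-- **Deliverable (d): the site energy of a layered set, layer by layer.** For `a ∈ [47/50, 1]`, a linear
isometry `A`, any label walk `s` and heights with increments in `[39a/50, ∞)`, the site energy of the point
`p₀ = A (i u + j v + L(m) w + z(m) e₃)` in `S(A, s, z)` is
`Φ₀(a) + ∑'_{m'} (if m' = m then 0 else layerInteraction V_LJ a (z m' − z m) (L m' − L m) 1)`. [folklore] -/
theorem cake_siteEnergy (a : ℝ) (ha : 47 / 50 ≤ a) (ha1 : a ≤ 1) (A : (EuclideanSpace ℝ (Fin 3)) →ₗᵢ[ℝ]
    (EuclideanSpace ℝ (Fin 3))) (s : ℤ → ℤ)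
    (z : ℤ → ℝ) (hz : ∀ m : ℤ, 39 / 50 * a ≤ z (m + 1) - z m) (m i j : ℤ) :
    (∑' q : {q : (EuclideanSpace ℝ (Fin 3)) // q ∈ {p : (EuclideanSpace ℝ (Fin 3)) | ∃ m i j : ℤ, p = A (((i : ℝ)
        • triangularVec₁ a) +
        ((j : ℝ) • triangularVec₂ a) + ((haggLabel s m : ℝ) • barlowOffset a) + (z m • layerNormal 1))} ∧
        q ≠ A (((i : ℝ) • triangularVec₁ a) + ((j : ℝ) • triangularVec₂ a) +
          ((haggLabel s m : ℝ) • barlowOffset a) + (z m • layerNormal 1))},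
      lennardJones (dist (A (((i : ℝ) • triangularVec₁ a) + ((j : ℝ) • triangularVec₂ a) +
        ((haggLabel s m : ℝ) • barlowOffset a) + (z m • layerNormal 1))) (q : (EuclideanSpace ℝ (Fin 3))))) =
    inLayerInteraction lennardJones a + ∑' m' : ℤ, if m' = m then (0 : ℝ) else
      layerInteraction lennardJones a (z m' - z m) (haggLabel s m' - haggLabel s m) 1 := by
  have ha0 : 0 < a := by linarith
  -- the parametrisation
  set e : ℤ × ℤ × ℤ → (EuclideanSpace ℝ (Fin 3)) := fun t => A (layerVec a (z t.1) (haggLabel s t.1) 1 t.2.1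
      t.2.2) with he
  have hpt : ∀ m i j : ℤ, A (((i : ℝ) • triangularVec₁ a) + ((j : ℝ) • triangularVec₂ a) +
      ((haggLabel s m : ℝ) • barlowOffset a) + (z m • layerNormal 1)) = e (m, i, j) := by
    intro m i j
    simp only [he, cake_pt_eq_layerVec]
  have hS : {p : (EuclideanSpace ℝ (Fin 3)) | ∃ m i j : ℤ, p = A (((i : ℝ) • triangularVec₁ a) + ((j : ℝ) •
      triangularVec₂ a) +
      ((haggLabel s m : ℝ) • barlowOffset a) + (z m • layerNormal 1))} = Set.range e := by
    ext p
    simp only [Set.mem_setOf_eq, Set.mem_range, hpt]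
    constructor
    · rintro ⟨m, i, j, rfl⟩; exact ⟨(m, i, j), rfl⟩
    · rintro ⟨⟨m, i, j⟩, rfl⟩; exact ⟨m, i, j, rfl⟩
  have hzinj : Function.Injective z := cake_height_injective a ha0 z hz
  have hinj : Function.Injective e := by
    rintro ⟨m₁, i₁, j₁⟩ ⟨m₂, i₂, j₂⟩ h
    obtain ⟨rfl, rfl, rfl⟩ := cake_param_injective a ha0.ne' (haggLabel s) z hzinj (A.injective h)
    rfl
  -- the family on `ℤ × ℤ × ℤ` and its slices
  set F : ℤ × ℤ × ℤ → ℝ := fun t => lennardJones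
    ‖layerVec a (z t.1 - z m) (haggLabel s t.1 - haggLabel s m) 1 (t.2.1 - i) (t.2.2 - j)‖ with hF
  set g : ℤ → ℤ × ℤ → ℝ := fun m' ij =>
    lennardJones ‖layerVec a (z m' - z m) (haggLabel s m' - haggLabel s m) 1 ij.1 ij.2‖ with hg
  have hfe : ∀ t, lennardJones (dist (e (m, i, j)) (e t)) = F t := by
    intro t
    rw [he, LinearIsometry.dist_map, dist_comm, dist_eq_norm, cake_layerVec_sub]
  have hFg : ∀ (m' : ℤ) (ij : ℤ × ℤ), F (m', ij) = g m' (Equiv.subRight ((i, j) : ℤ × ℤ) ij) :=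
    fun _ _ => rfl
  have hslice : ∀ m' : ℤ, Summable (fun ij : ℤ × ℤ => |g m' ij|) ∧
      (m' ≠ m → ∑' ij : ℤ × ℤ, |g m' ij| ≤ 192 / (z m' - z m) ^ 4) := by
    intro m'
    by_cases hm : m' = m
    · refine ⟨?_, fun h => absurd hm h⟩
      have h0 : g m' = fun ij : ℤ × ℤ => lennardJones ‖layerVec a 0 0 1 ij.1 ij.2‖ := by
        funext ij
        simp only [hg, hm, sub_self]
      rw [h0]
      exact cake_summable_abs_inLayer a ha ha1
    · have hH := cake_height_sep a ha z hz hm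
      exact ⟨(cake_summable_abs_layer a _ ha ha1 hH _).1, fun _ => (cake_summable_abs_layer a _ ha ha1 hH _).2⟩
  have habs_slice : ∀ m' : ℤ, Summable fun ij : ℤ × ℤ => |F (m', ij)| := fun m' =>
    ((Equiv.subRight ((i, j) : ℤ × ℤ)).summable_iff.2 (hslice m').1).congr fun ij => by
      rw [Function.comp_apply, hFg]
  have habs_tsum : ∀ m' : ℤ, ∑' ij : ℤ × ℤ, |F (m', ij)| = ∑' ij : ℤ × ℤ, |g m' ij| := fun m' => by
    simp only [hFg]
    exact Equiv.tsum_eq (Equiv.subRight ((i, j) : ℤ × ℤ)) (fun ij => |g m' ij|)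
  -- absolute summability on `ℤ × ℤ × ℤ`
  have hFabs : Summable fun t : ℤ × ℤ × ℤ => |F t| := by
    rw [summable_prod_of_nonneg fun _ => abs_nonneg _]
    refine ⟨habs_slice, cake_summable_of_layer_bound a ha z hz m _ fun m' hm => ?_⟩
    rw [abs_of_nonneg (tsum_nonneg fun _ => abs_nonneg _), habs_tsum]
    exact (hslice m').2 hm
  have hFsum : Summable F := hFabs.of_abs
  -- inner sums
  have hinner : ∀ m' : ℤ, ∑' ij : ℤ × ℤ, F (m', ij) =
      layerInteraction lennardJones a (z m' - z m) (haggLabel s m' - haggLabel s m) 1 := by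
    intro m'
    unfold layerInteraction
    simp only [hFg]
    exact Equiv.tsum_eq (Equiv.subRight ((i, j) : ℤ × ℤ)) (g m')
  have hself : layerInteraction lennardJones a (z m - z m) (haggLabel s m - haggLabel s m) 1 =
      inLayerInteraction lennardJones a := by
    rw [sub_self, sub_self, cake_layerInteraction_self]
  have h0 : lennardJones (dist (e (m, i, j)) (e (m, i, j))) = 0 := by rw [dist_self, lennardJones_zero]
  -- assemble
  rw [hS, hpt]
  calc ∑' q : {q : (EuclideanSpace ℝ (Fin 3)) // q ∈ Set.range e ∧ q ≠ e (m, i, j)}, lennardJones (dist (e (m, i,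
      j)) (q : (EuclideanSpace ℝ (Fin 3))))
      = ∑' q : Set.range e, lennardJones (dist (e (m, i, j)) (q : (EuclideanSpace ℝ (Fin 3)))) :=
        cake_tsum_subtype_ne_eq (fun q => lennardJones (dist (e (m, i, j)) q)) _ _ h0
    _ = ∑' t : ℤ × ℤ × ℤ, lennardJones (dist (e (m, i, j)) (e t)) :=
        tsum_range (fun q => lennardJones (dist (e (m, i, j)) q)) hinj
    _ = ∑' t : ℤ × ℤ × ℤ, F t := tsum_congr hfe
    _ = ∑' (m' : ℤ) (ij : ℤ × ℤ), F (m', ij) := hFsum.tsum_prod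
    _ = ∑' m' : ℤ, layerInteraction lennardJones a (z m' - z m) (haggLabel s m' - haggLabel s m) 1 :=
        tsum_congr hinner
    _ = _ := cake_tsum_eq_add_tsum_ite _ m _ hself (cake_summable_layers a ha ha1 s z hz m)

end Summit.AtomisticToContinuum.Crystallization.Theorems.LayeredHull
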